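import Summits.Schanuel.Schanuel.Theorems.ZilberEacDirectionalDominance
import Summits.Schanuel.Schanuel.Theorems.ZilberEacRealHyperplaneCell
import Summits.Schanuel.Schanuel.Theorems.ZilberEacComplexRealHyperplaneSlow
import HarnessLib

/-!
# Zariski density of the exponential points of `(s+2)`-FOLDS of `EC(s+2, s+1)`:
# moving targets over real hyperplanes in the slow regime (first density theorem for non-split
# 3-folds of the open cell `EC(3,2)`)

Zilber's Exponential-Algebraic Closedness, case ladder (host summit Schanuel, cell `pub-schanuel`,
seat 2, gen 9).  THE FAMILY (`s ≥ 0`, `r ∈ ℝ^{s+1}`, `c ∈ ℂ`, `Aⱼ ∈ ℂ[x₀..x_s]`, `Fⱼ ∈ ℂ[u]`):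

  `W = {x_{s+1} = ℓ(x) := Σ rᵢ xᵢ + c,  yⱼ = Aⱼ(x) + y_{s+1} Fⱼ(y_{s+1}) (j ≤ s)} ⊆ ℂ^{s+2} × ℂ^{s+2}`,

`= polyFibredGraph (hyperplanePoly r c) A (Fⱼ(u))`, an irreducible `(s+2)`-fold with
`dim π_add(W) = s + 1` whose exponential points are the solutions `x ∈ ℂ^{s+1}` of
`e^{xⱼ} = Aⱼ(x) + e^{ℓ(x)} Fⱼ(e^{ℓ(x)})`.  For `A` dominant and some `rᵢ ∉ ℚ` these are certified
members of the open cell `EC(s+2, s+1)` (`ZilberEacRealHyperplaneCell`), of `EC(3,2)` for `s = 1`.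
THEOREM R⁺ (`exists_expPoint_realHyperplane_slow`) solves the system near the lattice centres of
every ray `2πi m q` with `(Aⱼ)_{dⱼ}(2πi q) ≠ 0`, in the slow regime
`λ + max(λ,0) deg Fⱼ < dⱼ = deg Aⱼ`, `λ := Σ rᵢ dᵢ`.

**THEOREM (`unprojectedDense_polyFibredGraph_hyperplane_slow`).**  In the slow regime, if `Aⱼ ≠ 0`
for all `j` and `λ = Σ rᵢ dᵢ` is IRRATIONAL, the exponential points of `W` are ZARISKI DENSE in `W`:
`I(W ∩ Γ_exp) = I(W)`.

Proof: THEOREM J (`ZilberEacDirectionalDominance`) with the `s + 1` direction coordinates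
`x₀, …, x_s` and the power coordinate `y_{s+1} = e^{ℓ(x)}`: near the `m`-th centre of the ray `q`,
`x = 2πi m q + O(log m)` and `log |y_{s+1}| = Re ℓ(x) = λ log m + O(1)`; the admissible rays (leading
forms non-vanishing) are Zariski dense; `dim W = s + 2`.  For surfaces (`s = 0`) this re-proves the
density of the moving-target line family of real irrational slope in the slow regime; for `s ≥ 1` it
is NEW — the surface endgames THEOREMS G/G′/I use two coordinates and do not reach dimension `≥ 3`.

Corollaries: `unprojectedDense_realHyperplane_slow_member` (with the seven `ECCell (s+2) (s+1)`
hypotheses: certified members of the open cell with dense exponential points), the 3-fold example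
`sqrt_two_quarter_threefold_dense`: `W = {x₂ = (√2/4)(x₀ + x₁), y₀ = x₀ + y₂, y₁ = x₁ + y₂}`, a
certified member of `EC(3,2)`, has Zariski dense exponential points (solutions of
`e^{z} = z + e^{√2(z+w)/4}`, `e^{w} = w + e^{√2(z+w)/4}`).

HONEST FRAMING: explicit families inside an OPEN cell; existence was THEOREM R⁺ (gen 7), NEW is
the Zariski density in dimension `≥ 3`; `EC(3,2)` itself OPEN; NOT Schanuel's conjecture; EAC ⇏ SC.
-/

noncomputable section

open Complex MvPolynomial Filter Topology
open Literature.NumberTheory.Transcendental Literature.ModelTheory.Zilber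
  Literature.ModelTheory.ExponentialFields

set_option linter.dupNamespace false

namespace Summit.Schanuel.Schanuel.Theorems

section Density

variable {s : ℕ}

/-- An irrational real combination `Σ rᵢ dᵢ` of naturals has an irrational coefficient. [folklore] -/
theorem exists_irrational_of_irrational_sum {r : Fin (s + 1) → ℝ} {d : Fin (s + 1) → ℕ}
    (h : Irrational (∑ i, r i * d i)) : ∃ i, Irrational (r i) := by
  by_contra hcon
  push Not at hcon
  simp only [Irrational, not_not, Set.mem_range] at hcon
  choose ρ hρ using hcon
  apply h
  refine ⟨∑ i, ρ i * d i, ?_⟩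
  push_cast
  exact Finset.sum_congr rfl fun i _ => by rw [hρ i]

/-- The exponential point of `W` over a solution `x`: `pgParam` with `u = e^{ℓ(x)}` lies on `Γ_exp`
when `e^{xⱼ} = Aⱼ(x) + e^{ℓ(x)} Fⱼ(e^{ℓ(x)})` for all `j`. [folklore] -/
theorem pgParam_hyperplane_mem_expGraph (r : Fin (s + 1) → ℝ) (c : ℂ)
    (A : Fin (s + 1) → MvPolynomial (Fin (s + 1)) ℂ) (F : Fin (s + 1) → Polynomial ℂ)
    {x : Fin (s + 1) → ℂ}
    (hx : ∀ j, exp (x j) = eval x (A j) +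
      exp (∑ i, (r i : ℂ) * x i + c) * (F j).eval (exp (∑ i, (r i : ℂ) * x i + c))) :
    pgParam (hyperplanePoly r c) A (fun j => (F j).toMvPolynomial 0) x
      (exp (∑ i, (r i : ℂ) * x i + c)) ∈ expGraph ℂ (s + 2) := by
  rw [mem_expGraph_iff]
  intro i
  refine Fin.lastCases ?_ (fun j => ?_) i
  · rw [pgParam_inl_last, pgParam_inr, pMulParam_last, ExponentialRing.complex_exp_eq,
      eval_hyperplanePoly, ell]
  · rw [pgParam_inl_castSucc, pgParam_inr, pMulParam_castSucc, ExponentialRing.complex_exp_eq,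
      hx j, MvPolynomial.eval_toMvPolynomial, Fin.cons_zero]

/-- **Lattice-centre control.**  For `Aⱼ` with leading forms non-vanishing at a purely imaginary
direction `v` and the centres `centre_m = (m vⱼ + log Aⱼ(m v))ⱼ`: there is `K ≥ 0` such that for all
large `m` every `z` within `1/2` of `centre_m` has `‖z - m v‖ ≤ K log m` and
`|Re zⱼ - deg Aⱼ · log m| ≤ K` for all `j` (`|Aⱼ(m v)| ≍ m^{deg Aⱼ}`, `latticeValue_control`). [folklore] -/
theorem latticeCentre_control_of_leadingForm (A : Fin (s + 1) → MvPolynomial (Fin (s + 1)) ℂ)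
    (v : Fin (s + 1) → ℂ) (hv : ∀ i, (v i).re = 0)
    (hA : ∀ j, eval v (homogeneousComponent (A j).totalDegree (A j)) ≠ 0) :
    ∃ K : ℝ, 0 ≤ K ∧ ∀ᶠ m : ℕ in atTop, ∀ z : Fin (s + 1) → ℂ,
      ‖z - fun i => (m : ℂ) * v i + log (eval (fun k => (m : ℂ) * v k) (A i))‖ ≤ 1 / 2 →
      ‖z - fun i => (m : ℂ) * v i‖ ≤ K * Real.log m ∧
        ∀ j, |(z j).re - (A j).totalDegree * Real.log m| ≤ K := by
  have hctrl := fun i => latticeValue_control (A i) v (hA i) one_pos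
  choose ρ hρ t₀ ht₀ hc using hctrl
  set a : Fin (s + 1) → ℝ := fun i => ‖eval v (homogeneousComponent (A i).totalDegree (A i))‖ with ha
  have ha0 : ∀ i, 0 < a i := fun i => norm_pos_iff.2 (hA i)
  set K₀ : ℝ := ∑ i, (((A i).totalDegree : ℝ) + (|Real.log (a i / 2)| + |Real.log (2 * a i)| + Real.pi))
    with hK₀
  have hterm0 : ∀ i, 0 ≤ ((A i).totalDegree : ℝ) + (|Real.log (a i / 2)| + |Real.log (2 * a i)| + Real.pi) :=
    fun i => by positivity
  have hK₀0 : 0 ≤ K₀ := Finset.sum_nonneg fun i _ => hterm0 i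
  have hsingle : ∀ i, ((A i).totalDegree : ℝ) + (|Real.log (a i / 2)| + |Real.log (2 * a i)| + Real.pi) ≤ K₀ :=
    fun i => Finset.single_le_sum (f := fun i => ((A i).totalDegree : ℝ) +
      (|Real.log (a i / 2)| + |Real.log (2 * a i)| + Real.pi)) (fun i _ => hterm0 i) (Finset.mem_univ i)
  refine ⟨1 / 2 + K₀, by positivity, ?_⟩
  filter_upwards [eventually_all.2 fun i => tendsto_natCast_atTop_atTop.eventually_ge_atTop (t₀ i),
    (Real.tendsto_log_atTop.comp tendsto_natCast_atTop_atTop).eventually_ge_atTop (1 : ℝ)]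
    with m hmt hlog1 z hz
  have hlog1' : (1 : ℝ) ≤ Real.log m := hlog1
  set centre : Fin (s + 1) → ℂ := fun i => (m : ℂ) * v i + log (eval (fun k => (m : ℂ) * v k) (A i))
    with hcentre
  have hbounds : ∀ i, ‖centre i - (m : ℂ) * v i‖ ≤ K₀ * Real.log m ∧
      |(centre i).re - (A i).totalDegree * Real.log m| ≤ K₀ := by
    intro i
    obtain ⟨-, hlow, hupp, -⟩ := hc i m (hmt i)
    have hm1 : (1 : ℝ) ≤ m := (ht₀ i).trans (hmt i)
    obtain ⟨h1, h2, hlog⟩ := log_latticeValue_bounds (by have := ha0 i; positivity) hm1 hlow hupp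
    have e : centre i - (m : ℂ) * v i = log (eval (fun k => (m : ℂ) * v k) (A i)) := by
      simp only [hcentre]; ring
    have hre : (centre i).re = Real.log ‖eval (fun k => (m : ℂ) * v k) (A i)‖ := by
      rw [hcentre]
      dsimp only
      rw [Complex.add_re, Complex.log_re]
      have h0 : ((m : ℂ) * v i).re = 0 := by simp [hv i]
      rw [h0, zero_add]
    constructor
    · rw [e]
      refine hlog.trans ?_
      have := hsingle i
      have hpos : 0 ≤ |Real.log (a i / 2)| + |Real.log (2 * a i)| + Real.pi := by positivity
      nlinarith
    · rw [hre, abs_le]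
      have := hsingle i
      constructor
      · linarith [neg_abs_le (Real.log (a i / 2)), abs_nonneg (Real.log (2 * a i)), Real.pi_pos.le]
      · linarith [le_abs_self (Real.log (2 * a i)), abs_nonneg (Real.log (a i / 2)), Real.pi_pos.le]
  constructor
  · have hcv : ‖centre - fun i => (m : ℂ) * v i‖ ≤ K₀ * Real.log m :=
      (pi_norm_le_iff_of_nonneg (by positivity)).2 fun i => (hbounds i).1
    calc ‖z - fun i => (m : ℂ) * v i‖
        ≤ ‖z - centre‖ + ‖centre - fun i => (m : ℂ) * v i‖ := norm_sub_le_norm_sub_add_norm_sub _ _ _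
      _ ≤ 1 / 2 + K₀ * Real.log m := add_le_add hz hcv
      _ ≤ (1 / 2 + K₀) * Real.log m := by nlinarith
  · intro j
    have hδ : |(z j).re - (centre j).re| ≤ 1 / 2 := by
      rw [← Complex.sub_re]
      exact (Complex.abs_re_le_norm _).trans ((norm_le_pi_norm (z - centre) j).trans hz)
    have h := (hbounds j).2
    rw [abs_le] at hδ h ⊢
    constructor <;> linarith [hδ.1, hδ.2, h.1, h.2]

/-- `2πi q` is purely imaginary. [folklore] -/
theorem re_two_pi_I_mul_int (q : ℤ) : (2 * Real.pi * I * (q : ℂ)).re = 0 := by simp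

/-- **Growth of a real linear functional** along controlled points: if `|Re zⱼ - dⱼ log m| ≤ K` for
all `j` then `|Re(Σ rⱼ zⱼ + c) - (Σ rⱼ dⱼ) log m| ≤ Σ |rⱼ| K + ‖c‖`. [folklore] -/
theorem abs_re_linear_sub_le {r : Fin (s + 1) → ℝ} {c : ℂ} {z : Fin (s + 1) → ℂ} {d : Fin (s + 1) → ℝ}
    {K T : ℝ} (h : ∀ j, |(z j).re - d j * T| ≤ K) :
    |(∑ i, (r i : ℂ) * z i + c).re - (∑ i, r i * d i) * T| ≤ (∑ i, |r i|) * K + ‖c‖ := by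
  have hre : (∑ i, (r i : ℂ) * z i + c).re = ∑ i, r i * (z i).re + c.re := by
    simp only [Complex.add_re, Complex.re_sum, Complex.re_ofReal_mul]
  have hsum : ∑ i, r i * ((z i).re - d i * T) = (∑ i, r i * (z i).re) - ∑ i, r i * d i * T := by
    rw [← Finset.sum_sub_distrib]
    exact Finset.sum_congr rfl fun i _ => by ring
  rw [hre, Finset.sum_mul,
    show (∑ i, r i * (z i).re) + c.re - ∑ i, r i * d i * T = ∑ i, r i * ((z i).re - d i * T) + c.re by
      rw [hsum]; ring]
  calc |∑ i, r i * ((z i).re - d i * T) + c.re|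
      ≤ |∑ i, r i * ((z i).re - d i * T)| + |c.re| := abs_add_le _ _
    _ ≤ ∑ i, |r i * ((z i).re - d i * T)| + ‖c‖ :=
        add_le_add (Finset.abs_sum_le_sum_abs _ _) (Complex.abs_re_le_norm c)
    _ ≤ ∑ i, |r i| * K + ‖c‖ := by
        refine add_le_add (Finset.sum_le_sum fun i _ => ?_) le_rfl
        rw [abs_mul]
        exact mul_le_mul_of_nonneg_left (h i) (abs_nonneg _)
    _ = (∑ i, |r i|) * K + ‖c‖ := by rw [Finset.sum_mul]

/-- **THEOREM (Zariski density over real hyperplanes, slow regime, every dimension).**  See the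
module docstring: `Aⱼ ≠ 0`, `λ + max(λ,0) deg Fⱼ < deg Aⱼ` for all `j`, `λ = Σ rᵢ deg Aᵢ`
irrational ⟹ `I(W ∩ Γ_exp) = I(W)` for `W = polyFibredGraph (Σ rᵢXᵢ + c) A (Fⱼ(u))`. (new)
[cite: MantovaMasser2023, §1 p.5 (the open case dim π(V) = 2 in ℂ³×ℂˣ³)] -/
theorem unprojectedDense_polyFibredGraph_hyperplane_slow (r : Fin (s + 1) → ℝ) (c : ℂ)
    (A : Fin (s + 1) → MvPolynomial (Fin (s + 1)) ℂ) (hA0 : ∀ j, A j ≠ 0)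
    (F : Fin (s + 1) → Polynomial ℂ)
    (hlam : ∀ j, (∑ i, r i * (A i).totalDegree) +
      max (∑ i, r i * (A i).totalDegree) 0 * ((F j).natDegree : ℝ) < (A j).totalDegree)
    (hirr : Irrational (∑ i, r i * (A i).totalDegree)) :
    UnprojectedDense (polyFibredGraph (hyperplanePoly r c) A (fun j => (F j).toMvPolynomial 0)) := by
  classical
  -- the admissible directions: leading forms non-vanishing
  set L : MvPolynomial (Fin (s + 1)) ℂ := ∏ j, homogeneousComponent (A j).totalDegree (A j) with hL
  have hL0 : L ≠ 0 := Finset.prod_ne_zero_iff.2 fun j _ =>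
    ExpDominant.homogeneousComponent_totalDegree_ne_zero (hA0 j)
  have h2pi : (2 * Real.pi * I : ℂ) ≠ 0 := Complex.two_pi_I_ne_zero
  refine unprojectedDense_of_directional_growth (t := s + 1) (isIrreducibleClosed_polyFibredGraph _ _ _)
    (by rw [zariskiDim_polyFibredGraph]) (fun i => Sum.inl (Fin.castSucc i))
    (Sum.inr (Fin.last (s + 1))) hirr
    (Q := {v : Fin (s + 1) → ℂ | (∃ q : Fin (s + 1) → ℤ, v = fun i => 2 * Real.pi * I * (q i : ℂ)) ∧
      eval v L ≠ 0})
    (fun G hG => latticeDirections_dense hL0 h2pi G hG) ?_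
  rintro v ⟨⟨q, rfl⟩, hvL⟩
  -- leading forms do not vanish at `v = 2πi q`
  have hA : ∀ j, eval (fun i => 2 * Real.pi * I * (q i : ℂ))
      (homogeneousComponent (A j).totalDegree (A j)) ≠ 0 := by
    rw [hL, map_prod] at hvL
    exact fun j => (Finset.prod_ne_zero_iff.1 hvL) j (Finset.mem_univ j)
  -- THEOREM R⁺ along the ray, and a choice of solutions
  have hsol := exists_expPoint_realHyperplane_slow r c q A hA F hlam
  set good : ℕ → (Fin (s + 1) → ℂ) → Prop := fun m x =>
    ‖x - fun i => (m : ℂ) * (2 * Real.pi * I * (q i : ℂ)) +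
        log (eval (fun k => (m : ℂ) * (2 * Real.pi * I * (q k : ℂ))) (A i))‖ ≤ 1 / 2 ∧
      ∀ j, exp (x j) = eval x (A j) +
        exp (∑ i, (r i : ℂ) * x i + c) * (F j).eval (exp (∑ i, (r i : ℂ) * x i + c)) with hgood
  set xs : ℕ → Fin (s + 1) → ℂ := fun m => Classical.epsilon (good m) with hxs
  have hxs : ∀ᶠ m : ℕ in atTop, good m (xs m) := by
    filter_upwards [hsol] with m hm
    exact Classical.epsilon_spec hm
  set p : ℕ → Fin (s + 2) ⊕ Fin (s + 2) → ℂ := fun m =>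
    pgParam (hyperplanePoly r c) A (fun j => (F j).toMvPolynomial 0) (xs m)
      (exp (∑ i, (r i : ℂ) * xs m i + c)) with hp
  obtain ⟨K, hK0, hK⟩ := latticeCentre_control_of_leadingForm A _ (fun i => re_two_pi_I_mul_int (q i)) hA
  refine ⟨p, ?_, ⟨K, ?_⟩, ⟨(∑ i, |r i|) * K + ‖c‖, ?_⟩⟩
  · -- points of `W ∩ Γ_exp`
    filter_upwards [hxs] with m hm
    exact ⟨pgParam_mem _ _ _ _ _, pgParam_hyperplane_mem_expGraph r c A F hm.2⟩
  · -- `x = m v + O(log m)`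
    filter_upwards [hxs, hK] with m hm hKm
    have hcoord : (fun i => p m (Sum.inl (Fin.castSucc i))) = xs m := by
      funext i; simp [hp]
    rw [hcoord]
    exact (hKm (xs m) hm.1).1
  · -- `log |y_{s+1}| = Re ℓ(x) = λ log m + O(1)`
    filter_upwards [hxs, hK] with m hm hKm
    have hβ : p m (Sum.inr (Fin.last (s + 1))) = exp (∑ i, (r i : ℂ) * xs m i + c) := by
      simp [hp]
    rw [hβ, Complex.norm_exp, Real.log_exp]
    exact ⟨Complex.exp_ne_zero _, abs_re_linear_sub_le (hKm (xs m) hm.1).2⟩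

/-- **Certified members of the open cell with dense exponential points.**  For `A` dominant
(`aeval A` injective), every `Aⱼ ≠ 0`, `Fⱼ ∈ ℂ[u]` in the slow regime and `λ = Σ rᵢ deg Aᵢ`
irrational: `W = polyFibredGraph (Σ rᵢXᵢ + c) A F` satisfies all seven hypotheses of
`ECCell (s+2) (s+1)` AND `I(W ∩ Γ_exp) = I(W)`. (new)
[cite: MantovaMasser2023, §1 p.5 (the open case dim π(V) = 2 in ℂ³×ℂˣ³)] -/
theorem unprojectedDense_realHyperplane_slow_member (r : Fin (s + 1) → ℝ) (c : ℂ)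
    (A : Fin (s + 1) → MvPolynomial (Fin (s + 1)) ℂ)
    (hA : Function.Injective (aeval A : MvPolynomial (Fin (s + 1)) ℂ →ₐ[ℂ] MvPolynomial (Fin (s + 1)) ℂ))
    (hA0 : ∀ j, A j ≠ 0) (F : Fin (s + 1) → Polynomial ℂ)
    (hlam : ∀ j, (∑ i, r i * (A i).totalDegree) +
      max (∑ i, r i * (A i).totalDegree) 0 * ((F j).natDegree : ℝ) < (A j).totalDegree)
    (hirr : Irrational (∑ i, r i * (A i).totalDegree)) :
    (IsIrreducibleClosed ℂ (polyFibredGraph (hyperplanePoly r c) A (fun j => (F j).toMvPolynomial 0)) ∧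
      (polyFibredGraph (hyperplanePoly r c) A (fun j => (F j).toMvPolynomial 0) ∩
        torusLocus ℂ (s + 2)).Nonempty ∧
      IsRotund ℂ (s + 2) (polyFibredGraph (hyperplanePoly r c) A (fun j => (F j).toMvPolynomial 0) ∩
        torusLocus ℂ (s + 2)) ∧
      IsAddFree ℂ (s + 2) (polyFibredGraph (hyperplanePoly r c) A (fun j => (F j).toMvPolynomial 0) ∩
        torusLocus ℂ (s + 2)) ∧
      IsMulFree ℂ (s + 2) (polyFibredGraph (hyperplanePoly r c) A (fun j => (F j).toMvPolynomial 0) ∩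
        torusLocus ℂ (s + 2)) ∧
      zariskiDim ℂ (polyFibredGraph (hyperplanePoly r c) A (fun j => (F j).toMvPolynomial 0)) =
        (s + 2 : ℕ) ∧
      addProjDim ℂ (s + 2) (polyFibredGraph (hyperplanePoly r c) A (fun j => (F j).toMvPolynomial 0)) =
        (s + 1 : ℕ)) ∧
    UnprojectedDense (polyFibredGraph (hyperplanePoly r c) A (fun j => (F j).toMvPolynomial 0)) :=
  ⟨ecCell_hypotheses_polyFibredGraph_hyperplane r c A _ hA (exists_irrational_of_irrational_sum hirr),
    unprojectedDense_polyFibredGraph_hyperplane_slow r c A hA0 F hlam hirr⟩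

end Density

/-! ## A 3-fold of `EC(3,2)` with Zariski dense exponential points -/

section Example

/-- The 3-fold `W = {x₂ = (√2/4)(x₀ + x₁), y₀ = x₀ + y₂, y₁ = x₁ + y₂}` (fibre polynomials
`F₀ = F₁ = 1`), exponential points = solutions of `e^{z} = z + e^{√2(z+w)/4}`,
`e^{w} = w + e^{√2(z+w)/4}`. [cite: MantovaMasser2023, §1 p.5 (the open case dim π(V) = 2 in ℂ³×ℂˣ³)] -/
theorem sqrt_two_quarter_threefold_dense :
    (IsIrreducibleClosed ℂ (polyFibredGraph (hyperplanePoly ![Real.sqrt 2 / 4, Real.sqrt 2 / 4] 0)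
        (fun j => X j) (fun _ => (1 : Polynomial ℂ).toMvPolynomial 0)) ∧
      (polyFibredGraph (hyperplanePoly ![Real.sqrt 2 / 4, Real.sqrt 2 / 4] 0) (fun j => X j)
          (fun _ => (1 : Polynomial ℂ).toMvPolynomial 0) ∩ torusLocus ℂ 3).Nonempty ∧
      IsRotund ℂ 3 (polyFibredGraph (hyperplanePoly ![Real.sqrt 2 / 4, Real.sqrt 2 / 4] 0)
          (fun j => X j) (fun _ => (1 : Polynomial ℂ).toMvPolynomial 0) ∩ torusLocus ℂ 3) ∧
      IsAddFree ℂ 3 (polyFibredGraph (hyperplanePoly ![Real.sqrt 2 / 4, Real.sqrt 2 / 4] 0)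
          (fun j => X j) (fun _ => (1 : Polynomial ℂ).toMvPolynomial 0) ∩ torusLocus ℂ 3) ∧
      IsMulFree ℂ 3 (polyFibredGraph (hyperplanePoly ![Real.sqrt 2 / 4, Real.sqrt 2 / 4] 0)
          (fun j => X j) (fun _ => (1 : Polynomial ℂ).toMvPolynomial 0) ∩ torusLocus ℂ 3) ∧
      zariskiDim ℂ (polyFibredGraph (hyperplanePoly ![Real.sqrt 2 / 4, Real.sqrt 2 / 4] 0)
          (fun j => X j) (fun _ => (1 : Polynomial ℂ).toMvPolynomial 0)) = (3 : ℕ) ∧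
      addProjDim ℂ 3 (polyFibredGraph (hyperplanePoly ![Real.sqrt 2 / 4, Real.sqrt 2 / 4] 0)
          (fun j => X j) (fun _ => (1 : Polynomial ℂ).toMvPolynomial 0)) = (2 : ℕ)) ∧
    UnprojectedDense (polyFibredGraph (hyperplanePoly ![Real.sqrt 2 / 4, Real.sqrt 2 / 4] 0)
        (fun j => X j) (fun _ => (1 : Polynomial ℂ).toMvPolynomial 0)) := by
  have hA : Function.Injective (aeval (fun j : Fin 2 => (X j : MvPolynomial (Fin 2) ℂ)) :
      MvPolynomial (Fin 2) ℂ →ₐ[ℂ] MvPolynomial (Fin 2) ℂ) := by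
    rw [aeval_X_left]; exact fun _ _ h => h
  have hA0 : ∀ j : Fin 2, (X j : MvPolynomial (Fin 2) ℂ) ≠ 0 := fun j => X_ne_zero j
  have hdeg : ∀ j : Fin 2, (X j : MvPolynomial (Fin 2) ℂ).totalDegree = 1 := fun j => totalDegree_X j
  have hsum : (∑ i : Fin 2, (![Real.sqrt 2 / 4, Real.sqrt 2 / 4] : Fin 2 → ℝ) i *
      ((X i : MvPolynomial (Fin 2) ℂ).totalDegree : ℝ)) = Real.sqrt 2 / 2 := by
    rw [Fin.sum_univ_two, hdeg, hdeg]
    simp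
    ring
  have h2 : Real.sqrt 2 < 2 := by
    rw [Real.sqrt_lt' (by norm_num)]; norm_num
  have h2' : 0 < Real.sqrt 2 := Real.sqrt_pos.2 (by norm_num)
  have hlam : ∀ j : Fin 2, (∑ i : Fin 2, (![Real.sqrt 2 / 4, Real.sqrt 2 / 4] : Fin 2 → ℝ) i *
      ((X i : MvPolynomial (Fin 2) ℂ).totalDegree : ℝ)) +
      max (∑ i : Fin 2, (![Real.sqrt 2 / 4, Real.sqrt 2 / 4] : Fin 2 → ℝ) i *
        ((X i : MvPolynomial (Fin 2) ℂ).totalDegree : ℝ)) 0 *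
        (((fun _ => (1 : Polynomial ℂ)) j).natDegree : ℝ) <
      (X j : MvPolynomial (Fin 2) ℂ).totalDegree := by
    intro j
    rw [hsum, hdeg]
    simp only [Polynomial.natDegree_one, Nat.cast_zero, mul_zero, add_zero, Nat.cast_one]
    linarith
  have hirr : Irrational (∑ i : Fin 2, (![Real.sqrt 2 / 4, Real.sqrt 2 / 4] : Fin 2 → ℝ) i *
      ((X i : MvPolynomial (Fin 2) ℂ).totalDegree : ℝ)) := by
    rw [hsum]
    exact irrational_sqrt_two.div_natCast (m := 2) (by norm_num)
  exact unprojectedDense_realHyperplane_slow_member _ 0 _ hA hA0 (fun _ => 1) hlam hirr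

end Example

end Summit.Schanuel.Schanuel.Theorems

end
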